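import Mathlib
import Summits.CriticalPhenomena.CardyFormulaZ2.Theorems.CardyMagicRigidityDefs
import Summits.CriticalPhenomena.CardyFormulaZ2.Theorems.CardyMagicRigidityNestingRigidityOpenBCTypeSwapT
import Summits.CriticalPhenomena.CardyFormulaZ2.Theorems.CardyMagicRigidityNestingRigidityBondDuality
import Literature.Probability.Percolation.LoopRepresentationProofs
import Literature.Probability.Percolation.RSW
import HarnessLib

/-!
# Stub `stub_treeRigidity`, type step: both full-plane lattice ensembles are type-swap invariant in law

Crux `Summit.CriticalPhenomena.CardyFormulaZ2.Theses.CardyMagicRigidity.NestingRigidity`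
(stmt-CriticalPhenomena-4835), line `positive-cone-weight-doubling`, registered stub `stub_treeRigidity`.
Step (3) of its route (TYPES: along the nesting tree types alternate, and "the one remaining global type bit
is a fair coin independent of the untyped configuration") rests on the lattice symmetries exchanging the two
types: the colour flip of critical site percolation on `𝕋` and the self-duality of critical bond percolation
on `ℤ²` (up to the half-mesh shift `δ(1+i)/2`).  In the line's vocabulary (`tEns`, `zEns` of
`Theorems/CardyMagicRigidityDefs.lean`) and in DKKMO's coupling distance:

* `cnLawEDist_typeSwap_tEns` (registered anchor) — for every mesh `δ`, the typed full-plane loop ensemble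
  `tEns.X δ` and its TYPE SWAP `⟨fun i ↦ (tEns.X δ ω).F (1 - i)⟩` are at `d_CN = 0`: the whole-plane case
  `U = univ` of `cnLawEDist_openBC_typeSwap_T` (line `markov-cascade-one-generation`), since
  `triMeshVertices univ δ = univ` and `domLoopsT univ δ ω = tEns.X δ ω`.
* `cnLawEDist_typeSwap_zEns_le` — for every mesh `δ`, `d_CN(zEns.X δ, type swap of zEns.X δ) ≤ ‖δ(1+i)/2‖`
  (`= |δ|/√2 → 0`): couple `ω` with its dual configuration (`P_{1/2}`-preserving,
  `bondPercolation_map_dualConfig_holds`); the loops of the dual configuration are the loops of `ω`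
  reversed, type-swapped and shifted by `δ(1+i)/2` (`mem_bondLoopConfig_dualConfig_iff`, for `ω` inside the
  edge set, which holds a.s.), and a shift by `b` moves an unbased loop by at most `‖b‖`
  (`UnbasedLoop.dist_map_translate_le`); `tendsto_cnLawEDist_typeSwap_zEns`: hence `→ 0` as `δ → 0⁺`.

What remains for step (3) (see the audit of seat c4-0): pass these symmetries to the subsequential limits
(needs measurable presentations), or — recommended — run the fair-coin argument on the lattice and feed
TYPED joint count statistics to the reconstruction.
-/

noncomputable section

open MeasureTheory Set Filter Metric
open scoped Topology BigOperators ENNReal Real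

namespace Summit.CriticalPhenomena.CardyFormulaZ2.Cruxes.NestingRigidity.PositiveConeWeightDoubling

open Literature.Probability.RandomPlanarGeometry Literature.Probability.Percolation
  Literature.Probability.LatticeModels
open Summit.CriticalPhenomena.CardyFormulaZ2.Theses.CardyMagicRigidity
open Summit.CriticalPhenomena.CardyFormulaZ2.Cruxes.NestingRigidity.RingCloudTomography
open Summit.CriticalPhenomena.CardyFormulaZ2.Cruxes.NestingRigidity.MarkovCascadeOneGeneration

/-! ## Site-`𝕋`: colour flip -/

/-- With `U = univ` every vertex of `δ𝕋` is a mesh vertex of `U`. -/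
theorem triMeshVertices_univ (δ : ℝ) : triMeshVertices (univ : Set ℂ) δ = univ :=
  Set.eq_univ_of_forall fun _ ↦ trivial

/-- With `U = univ` the closed-b.c. domain ensemble of `𝕋` is the full-plane ensemble `tEns`. -/
theorem domLoopsT_univ (δ : ℝ) (ω : SiteConfig (Site 2)) : domLoopsT univ δ ω = tEns.X δ ω := by
  rw [domLoopsT, triMeshVertices_univ, inter_univ]
  rfl

/-- **Type-swap invariance of the full-plane site-`𝕋` loop ensemble, in law (registered anchor).**  For every
mesh `δ`, under critical site percolation the typed loop configuration `tEns.X δ` and its type swap (the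
families `F 0`, `F 1` exchanged) are at DKKMO coupling distance `d_CN = 0`: couple `ω` with its colour flip
`ωᶜ` (`P_{1/2}`-preserving), under which every interface loop reappears reversed with the opposite type. -/
theorem cnLawEDist_typeSwap_tEns : ∀ δ : ℝ,
    LoopConfig.cnLawEDist tEns.P (tEns.X δ) tEns.P
      (fun ω ↦ (⟨fun i ↦ (tEns.X δ ω).F (1 - i)⟩ : LoopConfig ℂ)) = 0 := by
  intro δ
  have h := cnLawEDist_openBC_typeSwap_T univ δ
  simp only [triMeshVertices_univ, compl_univ, union_empty, domLoopsT_univ] at h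
  exact h

/-! ## Bond-`ℤ²`: self-duality and the half-mesh shift -/

/-- **A shift by `b` moves an unbased loop by at most `‖b‖`** in the unbased oriented distance (the shifted
parametrisation is pointwise at distance `‖b‖`). -/
theorem _root_.Literature.Probability.RandomPlanarGeometry.UnbasedLoop.dist_map_translate_le
    (u : UnbasedLoop ℂ) (b : ℂ) :
    dist (u.map ⟨fun w ↦ 1 * w + b, continuous_translate b⟩ (isometry_translate b)) u ≤ ‖b‖ := by
  obtain ⟨⟨c, hc⟩, rfl⟩ := UnbasedLoop.mk_surjective u
  obtain ⟨γ, rfl⟩ := CurveClass.surjective_mk c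
  rw [UnbasedLoop.map_mk, UnbasedLoop.dist_mk_mk, BasedLoop.dist_def]
  change CurveClass.loopDist (CurveClass.map _ (CurveClass.mk γ)) (CurveClass.mk γ) ≤ ‖b‖
  rw [CurveClass.map_mk, CurveClass.loopDist_mk]
  refine (Curve.loopDist_le_reparamDist _ _).trans ((Curve.reparamDist_le_dist _ _).trans ?_)
  refine ContinuousMap.dist_le (norm_nonneg b) |>.2 fun t ↦ ?_
  change dist ((γ.map _) t) (γ t) ≤ ‖b‖
  rw [Curve.map_apply, ContinuousMap.coe_mk, one_mul, dist_eq_norm, add_sub_cancel_left]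

/-- **Sure closeness on the graph of duality.**  For `ω` inside the edge set of `ℤ²` and every
`ε ≥ ‖δ(1+i)/2‖`, the loop representation of `ω` and the TYPE SWAP of the loop representation of the dual
configuration satisfy `d_CN ≤ ε`: a type-`i` loop `v` of `ω` is partnered with the shift by `−δ(1+i)/2` of
its reversal, which is a type-`(1 - i)` loop of the dual configuration (`mem_bondLoopConfig_dualConfig_iff`),
at loop distance `≤ ‖δ(1+i)/2‖`; and conversely. -/
theorem isClose_bondLoopConfig_typeSwap_dualConfig {δ ε : ℝ} (hε : ‖(δ : ℂ) * (1 + Complex.I) / 2‖ ≤ ε)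
    {ω : BondConfig (Site 2)} (hω : ω ⊆ (zdGraph 2).edgeSet) :
    LoopConfig.IsClose ε (bondLoopConfig δ 0 ω)
      (⟨fun i ↦ (bondLoopConfig δ 0 (dualConfig ω)).F (1 - i)⟩ : LoopConfig ℂ) := by
  set b : ℂ := δ * (1 + Complex.I) / 2 with hb
  have key := mem_bondLoopConfig_dualConfig_iff δ ω hω
  -- the shift by `-b` undoes the shift by `b`
  have hshift : ∀ v : UnbasedLoop ℂ,
      (v.map ⟨fun w ↦ 1 * w + -b, continuous_translate (-b)⟩ (isometry_translate (-b))).map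
        ⟨fun w ↦ 1 * w + b, continuous_translate b⟩ (isometry_translate b) = v := fun v ↦ by
    rw [UnbasedLoop.map_map]
    convert UnbasedLoop.map_id v using 2
    ext w
    simp
  intro i
  refine ⟨fun v hv _ ↦ ?_, fun u hu _ ↦ ?_⟩
  · -- partner: the shift by `-b` of the reversal of `v`
    refine ⟨(v.map ⟨fun w ↦ 1 * w + -b, continuous_translate (-b)⟩ (isometry_translate (-b))).reverse,
      ?_, ?_⟩
    · change _ ∈ (bondLoopConfig δ 0 (dualConfig ω)).F (1 - i)
      rw [key, ← UnbasedLoop.reverse_map, UnbasedLoop.reverse_reverse, hshift, sub_sub_cancel]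
      exact hv
    · rw [UnbasedLoop.udist_reverse_right]
      refine (UnbasedLoop.udist_le_dist _ _).trans ?_
      rw [dist_comm]
      exact ((UnbasedLoop.dist_map_translate_le v (-b)).trans_eq (norm_neg b)).trans hε
  · -- partner: the reversal of the shift by `b` of `u`
    change u ∈ (bondLoopConfig δ 0 (dualConfig ω)).F (1 - i) at hu
    rw [key, sub_sub_cancel] at hu
    refine ⟨_, hu, ?_⟩
    rw [UnbasedLoop.udist_reverse_right, UnbasedLoop.udist_comm]
    exact ((UnbasedLoop.udist_le_dist _ _).trans (UnbasedLoop.dist_map_translate_le u b)).trans hε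

/-- **Type-swap invariance of the full-plane bond-`ℤ²` loop ensemble, in law, up to the half-mesh shift.**
For every mesh `δ`, under critical bond percolation the typed loop configuration `zEns.X δ` and its type swap
are at DKKMO coupling distance `d_CN ≤ ‖δ(1+i)/2‖ = |δ|/√2`: couple `ω` with `dualConfig ω`
(`P_{1/2}`-preserving), use `isClose_bondLoopConfig_typeSwap_dualConfig` on the a.s. event `ω ⊆ E(ℤ²)`,
and bound the exceptional event by the (measurable) complement of the graph of `dualConfig` on that event. -/
theorem cnLawEDist_typeSwap_zEns_le (δ : ℝ) :
    LoopConfig.cnLawEDist zEns.P (zEns.X δ) zEns.P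
        (fun ω ↦ (⟨fun i ↦ (zEns.X δ ω).F (1 - i)⟩ : LoopConfig ℂ)) ≤
      ENNReal.ofReal ‖(δ : ℂ) * (1 + Complex.I) / 2‖ := by
  change LoopConfig.cnLawEDist P2 (bondLoopConfig δ 0) P2
    (fun ω ↦ (⟨fun i ↦ (bondLoopConfig δ 0 ω).F (1 - i)⟩ : LoopConfig ℂ)) ≤ _
  refine (LoopConfig.cnLawEDist_le_iff_forall_lt (norm_nonneg _)).2 fun ε hε ↦ ?_
  have hε0 : 0 < ε := (norm_nonneg _).trans_lt hε
  have hf : Measurable fun ω : BondConfig (Site 2) ↦ (ω, dualConfig ω) :=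
    measurable_id.prodMk measurable_dualConfig
  refine ⟨P2.map fun ω ↦ (ω, dualConfig ω), ?_, ?_, ?_⟩
  · rw [Measure.map_map measurable_fst hf]
    exact Measure.map_id
  · rw [Measure.map_map measurable_snd hf]
    change P2.map dualConfig = P2
    exact (bondPercolation_map_dualConfig_holds half).trans (by rw [symm_half])
  · -- the exceptional event lies in `{p | p.2 ≠ dualConfig p.1} ∪ {p | ¬ p.1 ⊆ E}`, a null measurable set
    have hE : MeasurableSet {ω : BondConfig (Site 2) | ω ⊆ (zdGraph 2).edgeSet} := by
      have : {ω : BondConfig (Site 2) | ω ⊆ (zdGraph 2).edgeSet} =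
          ⋂ e ∈ ((zdGraph 2).edgeSetᶜ : Set (Sym2 (Site 2))), {ω | e ∉ ω} := by
        ext ω
        simp only [mem_setOf_eq, mem_iInter, mem_compl_iff]
        exact ⟨fun h e he heω ↦ he (h heω), fun h e heω ↦ by_contra fun he ↦ h e he heω⟩
      rw [this]
      exact MeasurableSet.biInter (Set.to_countable _) fun e _ ↦ (measurableSet_mem e).compl
    have hT : MeasurableSet ({p : BondConfig (Site 2) × BondConfig (Site 2) | p.2 = dualConfig p.1}ᶜ ∪
        {p | ¬ p.1 ⊆ (zdGraph 2).edgeSet}) := by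
      haveI := standardBorelSpace_bondConfig
      exact (measurableSet_eq_fun measurable_snd (measurable_dualConfig.comp measurable_fst)).compl.union
        (hE.compl.preimage measurable_fst)
    refine lt_of_le_of_lt (measure_mono (show _ ⊆ {p : BondConfig (Site 2) × BondConfig (Site 2) |
        p.2 = dualConfig p.1}ᶜ ∪ {p | ¬ p.1 ⊆ (zdGraph 2).edgeSet} from ?_)) ?_
    · rintro ⟨ω, ω'⟩ hp
      by_contra h
      simp only [mem_union, mem_compl_iff, mem_setOf_eq, not_or, not_not] at h
      obtain ⟨rfl, hω⟩ := h
      exact hp (isClose_bondLoopConfig_typeSwap_dualConfig hε.le hω)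
    · rw [Measure.map_apply hf hT]
      have he : (fun ω : BondConfig (Site 2) ↦ (ω, dualConfig ω)) ⁻¹'
          ({p : BondConfig (Site 2) × BondConfig (Site 2) | p.2 = dualConfig p.1}ᶜ ∪
            {p | ¬ p.1 ⊆ (zdGraph 2).edgeSet}) = {ω | ¬ ω ⊆ (zdGraph 2).edgeSet} := by
        ext ω; simp
      rw [he, show P2 {ω : BondConfig (Site 2) | ¬ ω ⊆ (zdGraph 2).edgeSet} = 0 from
        ae_iff.1 (ae_subset_edgeSet (zdGraph 2) half)]
      exact ENNReal.ofReal_pos.2 hε0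

/-- **Asymptotic type-swap invariance of bond-`ℤ²`**: `d_CN(zEns.X δ, type swap of zEns.X δ) → 0` as
`δ → 0⁺` (the bound `|δ|/√2` of `cnLawEDist_typeSwap_zEns_le`). -/
theorem tendsto_cnLawEDist_typeSwap_zEns :
    Tendsto (fun δ : ℝ ↦ LoopConfig.cnLawEDist zEns.P (zEns.X δ) zEns.P
      (fun ω ↦ (⟨fun i ↦ (zEns.X δ ω).F (1 - i)⟩ : LoopConfig ℂ))) (𝓝[>] 0) (𝓝 0) := by
  have hlim : Tendsto (fun δ : ℝ ↦ ENNReal.ofReal ‖(δ : ℂ) * (1 + Complex.I) / 2‖) (𝓝[>] 0) (𝓝 0) := by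
    rw [← ENNReal.ofReal_zero]
    refine ENNReal.tendsto_ofReal (tendsto_nhdsWithin_of_tendsto_nhds ?_)
    have : (fun δ : ℝ ↦ ‖(δ : ℂ) * (1 + Complex.I) / 2‖) = fun δ ↦ |δ| * (‖(1 : ℂ) + Complex.I‖ / 2) := by
      funext δ
      rw [norm_div, norm_mul, Complex.norm_real, Real.norm_eq_abs, Complex.norm_two]
      ring
    rw [this]
    have h0 : Tendsto (fun δ : ℝ ↦ |δ| * (‖(1 : ℂ) + Complex.I‖ / 2)) (𝓝 0)
        (𝓝 (|(0 : ℝ)| * (‖(1 : ℂ) + Complex.I‖ / 2))) :=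
      ((continuous_abs.tendsto (0 : ℝ)).mul_const _)
    simpa using h0
  exact tendsto_of_tendsto_of_tendsto_of_le_of_le tendsto_const_nhds hlim (fun _ ↦ bot_le)
    fun δ ↦ cnLawEDist_typeSwap_zEns_le δ

end Summit.CriticalPhenomena.CardyFormulaZ2.Cruxes.NestingRigidity.PositiveConeWeightDoubling

end
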